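import Summits.MatrixMultiplication.OmegaCensus.DihedralLikeTiling
import Summits.MatrixMultiplication.OmegaCensus.CubeRootObstruction
import HarnessLib

/-!
# Structure theorem for domino cube law triples — character core

ω-census `pub-omega`, family (b3), seat pub-omega-group gen 6.  Framing: lottery ticket; floor = certified bounds/negative
ranges.  VALUE: a theorem about the group-theoretic method (TPP triples in dihedral-like groups); NOT progress on ω.

Additive setting (see `THEORY-structure-1de.md` of the cell and `DominoStructure.lean` for the TPP wrapper): finite abelian `A`
with `3 ∤ |A|`, sets `T₀, T₁` (same size) and `U₀, U₁` (same size) whose character sums `τᵢ = ∑_{Tᵢ} ψ`, `υⱼ = ∑_{Uⱼ} ψ`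
satisfy, for every non-trivial `ψ`, the four *unit equations* coming from the near-tilings
`(T₀+U₀) ⊔ (T₁+U₀) ⊔ (T₀+U₁) = A ∖ {x₀}`, `(T₁+U₁) ⊔ (T₀+U₁) ⊔ (T₁+U₀) = A ∖ {x₇}` and their difference-set companions
`(U₀−T₁) ⊔ (U₀−T₀) ⊔ (U₁−T₁) = A ∖ {y₀}`, `(U₁−T₀) ⊔ (U₁−T₁) ⊔ (U₀−T₀) = A ∖ {y₇}`:
`(τ₀+τ₁)υ₀ + τ₀υ₁ = −ψ x₀`, `τ₁υ₀ + (τ₀+τ₁)υ₁ = −ψ x₇`, `(τ̄₀+τ̄₁)υ₀ + τ̄₁υ₁ = −ψ y₀`, `τ̄₀υ₀ + (τ̄₀+τ̄₁)υ₁ = −ψ y₇`.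

**Theorem (`domino_structure_of_charsums`).** Then `T₁ = (x₀ − y₀) − T₀` and `U₁ = (x₀ + y₇) − U₀`.

Proof (all at one character, then Fourier injectivity `finset_eq_of_charsum_eq`): comparing `|·|²` of the four equations
gives `(|τ₀+τ₁|² − |τ₀|²)(|υ₀|² − |υ₁|²) = 0 = (|τ₁|² − |τ₀+τ₁|²)(|υ₀|² − |υ₁|²)` and two symmetric identities; a triple
`|τ₀| = |τ₁| = |τ₀+τ₁| ≠ 0` would make `τ₁/τ₀` a primitive cube root of unity, excluded by `CubeRootObstruction`; hence both
pairs are homometric (`|τ₀| = |τ₁|`, `|υ₀| = |υ₁|`), then `Δ = τ₀²+τ₀τ₁+τ₁² = ψ(x₀−y₀)·S` with `S = |τ₀|² + 2Re τ₀τ̄₁` and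
`τ₁ S = Δ τ̄₀`, so `τ₁ = ψ(x₀ − y₀) τ̄₀`.
-/

namespace Summit.MatrixMultiplication.OmegaCensus

open Finset

/-! ## Complex-number core -/

section Core

open ComplexConjugate

/-- Homometry of the second pair from the four unit equations (and their conjugates). [folklore] -/
theorem homometric_of_unit_eqs (t₀ t₁ s₀ s₁ u₀ u₁ v₀ v₁ p₀ p₇ q₀ q₇ p₀' p₇' q₀' q₇' : ℂ)
    (hs₀ : s₀ = conj t₀) (hs₁ : s₁ = conj t₁)
    (hp₀ : p₀ * p₀' = 1) (hp₇ : p₇ * p₇' = 1) (hq₀ : q₀ * q₀' = 1) (hq₇ : q₇ * q₇' = 1)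
    (hu1 : (t₀ + t₁) * u₀ + t₀ * u₁ = -p₀) (hu2 : t₁ * u₀ + (t₀ + t₁) * u₁ = -p₇)
    (hu3 : (s₀ + s₁) * u₀ + s₁ * u₁ = -q₀) (hu4 : s₀ * u₀ + (s₀ + s₁) * u₁ = -q₇)
    (hv1 : (s₀ + s₁) * v₀ + s₀ * v₁ = -p₀') (hv2 : s₁ * v₀ + (s₀ + s₁) * v₁ = -p₇')
    (hv3 : (t₀ + t₁) * v₀ + t₁ * v₁ = -q₀') (hv4 : t₀ * v₀ + (t₀ + t₁) * v₁ = -q₇')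
    (hΩ : t₀ ^ 2 + t₀ * t₁ + t₁ ^ 2 = 0 → t₀ = 0 ∧ t₁ = 0) :
    u₀ * v₀ = u₁ * v₁ := by
  -- (c) and (d): `(πσ − t₀s₀)(u₀v₀ − u₁v₁) = 0`, `(t₁s₁ − πσ)(u₀v₀ − u₁v₁) = 0`
  have hc : ((t₀ + t₁) * (s₀ + s₁) - t₀ * s₀) * (u₀ * v₀ - u₁ * v₁) = 0 := by
    linear_combination ((s₀ + s₁) * v₀ + s₀ * v₁) * hu1 - p₀ * hv1 - (t₀ * v₀ + (t₀ + t₁) * v₁) * hu4 +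
      q₇ * hv4 + hp₀ - hq₇
  have hd : (t₁ * s₁ - (t₀ + t₁) * (s₀ + s₁)) * (u₀ * v₀ - u₁ * v₁) = 0 := by
    linear_combination (s₁ * v₀ + (s₀ + s₁) * v₁) * hu2 - p₇ * hv2 - ((t₀ + t₁) * v₀ + t₁ * v₁) * hu3 +
      q₀ * hv3 + hp₇ - hq₀
  by_contra hne
  have hne' : u₀ * v₀ - u₁ * v₁ ≠ 0 := sub_ne_zero.2 hne
  have h1 : (t₀ + t₁) * (s₀ + s₁) = t₀ * s₀ := by
    have := (mul_eq_zero.1 hc).resolve_right hne'; exact (sub_eq_zero.1 this)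
  have h2 : t₁ * s₁ = (t₀ + t₁) * (s₀ + s₁) := by
    have := (mul_eq_zero.1 hd).resolve_right hne'; exact (sub_eq_zero.1 this)
  -- `t₀s₀ = t₁s₁` and `t₀s₁ + t₁s₀ + t₁s₁ = 0`, whence `(t₀² + t₀t₁ + t₁²) s₁² = 0`
  have e1 : t₀ * s₀ - t₁ * s₁ = 0 := by linear_combination -h1 - h2
  have e2 : t₁ * s₁ + t₀ * s₁ + t₁ * s₀ = 0 := by linear_combination h1
  have key : (t₀ ^ 2 + t₀ * t₁ + t₁ ^ 2) * s₁ ^ 2 = 0 := by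
    linear_combination (t₀ * s₁) * e2 - (t₁ * s₁) * e1
  have ht : t₀ = 0 ∧ t₁ = 0 := by
    rcases mul_eq_zero.1 key with h | h
    · exact hΩ h
    · have hs1 : s₁ = 0 := pow_eq_zero_iff two_ne_zero |>.1 h
      have ht1 : t₁ = 0 := by
        rw [hs₁] at hs1; simpa using hs1
      have ht0 : t₀ = 0 := by
        have h0 : t₀ * s₀ = 0 := by linear_combination e1 + s₁ * ht1
        rw [hs₀, Complex.mul_conj] at h0
        have h0' : Complex.normSq t₀ = 0 := by exact_mod_cast h0
        exact Complex.normSq_eq_zero.1 h0'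
      exact ⟨ht0, ht1⟩
  obtain ⟨ht0, ht1⟩ := ht
  have : p₀ = 0 := by
    have := hu1; rw [ht0, ht1] at this; linear_combination this
  rw [this, zero_mul] at hp₀
  exact zero_ne_one hp₀

/-- Structure at one character: both pairs homometric, then `t₁ = ψ(x₀ − y₀) t̄₀` and `u₁ = ψ(x₀ + y₇) ū₀`.
Here `p₀ = ψ x₀, p₀' = ψ(−x₀)`, …, `q₇' = ψ(−y₇)`, `sᵢ = τ̄ᵢ`, `vⱼ = ῡⱼ`. [folklore] -/
theorem reflect_of_unit_eqs (t₀ t₁ s₀ s₁ u₀ u₁ v₀ v₁ p₀ p₇ q₀ q₇ p₀' p₇' q₀' q₇' : ℂ)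
    (hs₀ : s₀ = conj t₀) (hs₁ : s₁ = conj t₁) (hv₀ : v₀ = conj u₀) (hv₁ : v₁ = conj u₁)
    (hp₀ : p₀ * p₀' = 1) (hp₇ : p₇ * p₇' = 1) (hq₀ : q₀ * q₀' = 1) (hq₇ : q₇ * q₇' = 1)
    (hu1 : (t₀ + t₁) * u₀ + t₀ * u₁ = -p₀) (hu2 : t₁ * u₀ + (t₀ + t₁) * u₁ = -p₇)
    (hu3 : (s₀ + s₁) * u₀ + s₁ * u₁ = -q₀) (hu4 : s₀ * u₀ + (s₀ + s₁) * u₁ = -q₇)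
    (hv1 : (s₀ + s₁) * v₀ + s₀ * v₁ = -p₀') (hv2 : s₁ * v₀ + (s₀ + s₁) * v₁ = -p₇')
    (hv3 : (t₀ + t₁) * v₀ + t₁ * v₁ = -q₀') (hv4 : t₀ * v₀ + (t₀ + t₁) * v₁ = -q₇')
    (hΩT : t₀ ^ 2 + t₀ * t₁ + t₁ ^ 2 = 0 → t₀ = 0 ∧ t₁ = 0)
    (hΩU : u₀ ^ 2 + u₀ * u₁ + u₁ ^ 2 = 0 → u₀ = 0 ∧ u₁ = 0) :
    t₁ = p₀ * q₀' * s₀ ∧ u₁ = p₀ * q₇ * v₀ := by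
  -- homometry of both pairs
  have HU : u₀ * v₀ = u₁ * v₁ :=
    homometric_of_unit_eqs t₀ t₁ s₀ s₁ u₀ u₁ v₀ v₁ p₀ p₇ q₀ q₇ p₀' p₇' q₀' q₇' hs₀ hs₁ hp₀ hp₇ hq₀ hq₇
      hu1 hu2 hu3 hu4 hv1 hv2 hv3 hv4 hΩT
  have HT : t₀ * s₀ = t₁ * s₁ :=
    homometric_of_unit_eqs u₀ u₁ v₀ v₁ t₀ t₁ s₀ s₁ p₀ p₇ q₇' q₀' p₀' p₇' q₇ q₀ hv₀ hv₁ hp₀ hp₇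
      (by rw [mul_comm]; exact hq₇) (by rw [mul_comm]; exact hq₀)
      (by linear_combination hu1) (by linear_combination hu2) (by linear_combination hv4) (by linear_combination hv3)
      (by linear_combination hv1) (by linear_combination hv2) (by linear_combination hu4) (by linear_combination hu3) hΩU
  have np₀ : p₀ ≠ 0 := fun h => by rw [h, zero_mul] at hp₀; exact zero_ne_one hp₀
  constructor
  · -- T side
    -- `Δ u₀ = −π p₀ + t₀ p₇`, `Δ u₁ = −π p₇ + t₁ p₀`; then Δ·(hu3) with HT gives `S p₀ = Δ q₀`, `S = πσ − t₁ s₁`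
    have hSΔ : ((t₀ + t₁) * (s₀ + s₁) - t₁ * s₁) * p₀ = (t₀ ^ 2 + t₀ * t₁ + t₁ ^ 2) * q₀ := by
      linear_combination ((s₀ + s₁) * (t₀ + t₁) - s₁ * t₁) * hu1 + (s₁ * (t₀ + t₁) - (s₀ + s₁) * t₀) * hu2 -
        (t₀ ^ 2 + t₀ * t₁ + t₁ ^ 2) * hu3 + p₇ * HT
    -- `t₁ S = Δ s₀` given HT
    have hid : t₁ * ((t₀ + t₁) * (s₀ + s₁) - t₁ * s₁) = (t₀ ^ 2 + t₀ * t₁ + t₁ ^ 2) * s₀ := by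
      linear_combination (-t₀) * HT
    -- hence `S (t₁ − p₀ q₀' s₀) = 0`
    have hfac : ((t₀ + t₁) * (s₀ + s₁) - t₁ * s₁) * (t₁ - p₀ * q₀' * s₀) = 0 := by
      linear_combination hid - q₀' * s₀ * hSΔ - (t₀ ^ 2 + t₀ * t₁ + t₁ ^ 2) * s₀ * hq₀
    rcases mul_eq_zero.1 hfac with hS | h
    · -- `S = 0 ⇒ Δ q₀ = 0 ⇒ Δ = 0 ⇒ t = 0 ⇒ p₀ = 0`: contradiction
      exfalso
      have nq₀ : q₀ ≠ 0 := fun h => by rw [h, zero_mul] at hq₀; exact zero_ne_one hq₀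
      have hΔ : t₀ ^ 2 + t₀ * t₁ + t₁ ^ 2 = 0 := by
        have : (t₀ ^ 2 + t₀ * t₁ + t₁ ^ 2) * q₀ = 0 := by rw [← hSΔ, hS, zero_mul]
        exact (mul_eq_zero.1 this).resolve_right nq₀
      obtain ⟨ht0, ht1⟩ := hΩT hΔ
      apply np₀
      have := hu1; rw [ht0, ht1] at this; linear_combination this
    · exact sub_eq_zero.1 h
  · -- U side (same computation with the roles of T and U exchanged)
    have hSΔ : ((u₀ + u₁) * (v₀ + v₁) - u₁ * v₁) * p₀ = (u₀ ^ 2 + u₀ * u₁ + u₁ ^ 2) * q₇' := by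
      linear_combination ((v₀ + v₁) * (u₀ + u₁) - v₁ * u₁) * hu1 + (v₁ * (u₀ + u₁) - (v₀ + v₁) * u₀) * hu2 -
        (u₀ ^ 2 + u₀ * u₁ + u₁ ^ 2) * hv4 + p₇ * HU
    have hid : u₁ * ((u₀ + u₁) * (v₀ + v₁) - u₁ * v₁) = (u₀ ^ 2 + u₀ * u₁ + u₁ ^ 2) * v₀ := by
      linear_combination (-u₀) * HU
    have hfac : ((u₀ + u₁) * (v₀ + v₁) - u₁ * v₁) * (u₁ - p₀ * q₇ * v₀) = 0 := by
      linear_combination hid - q₇ * v₀ * hSΔ - (u₀ ^ 2 + u₀ * u₁ + u₁ ^ 2) * v₀ * hq₇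
    rcases mul_eq_zero.1 hfac with hS | h
    · exfalso
      have nq : q₇' ≠ 0 := fun h => by rw [h, mul_zero] at hq₇; exact zero_ne_one hq₇
      have hΔ : u₀ ^ 2 + u₀ * u₁ + u₁ ^ 2 = 0 := by
        have : (u₀ ^ 2 + u₀ * u₁ + u₁ ^ 2) * q₇' = 0 := by rw [← hSΔ, hS, zero_mul]
        exact (mul_eq_zero.1 this).resolve_right nq
      obtain ⟨hu0', hu1'⟩ := hΩU hΔ
      apply np₀
      have := hu1; rw [hu0', hu1'] at this; linear_combination this
    · exact sub_eq_zero.1 h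

end Core

/-! ## Fourier injectivity and reflected sets -/

section Fourier

variable {A : Type*} [AddCommGroup A] [Fintype A] [DecidableEq A]

/-- Two finite subsets of a finite abelian group with the same character sums coincide. [folklore] -/
theorem finset_eq_of_charsum_eq {X Y : Finset A} (h : ∀ ψ : AddChar A ℂ, ∑ a ∈ X, ψ a = ∑ a ∈ Y, ψ a) : X = Y := by
  have key : ∀ (Z : Finset A) (z : A), ∑ ψ : AddChar A ℂ, (∑ a ∈ Z, ψ a) * ψ (-z) =
      if z ∈ Z then (Fintype.card A : ℂ) else 0 := by
    intro Z z
    have e1 : ∀ ψ : AddChar A ℂ, (∑ a ∈ Z, ψ a) * ψ (-z) = ∑ a ∈ Z, ψ (a + -z) := fun ψ => by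
      rw [sum_mul]; exact sum_congr rfl fun a _ => (AddChar.map_add_eq_mul ψ a (-z)).symm
    simp_rw [e1]
    rw [sum_comm]
    simp_rw [AddChar.sum_apply_eq_ite, add_neg_eq_zero]
    rw [sum_ite_eq']
  ext z
  have hz := key X z
  rw [show (∑ ψ : AddChar A ℂ, (∑ a ∈ X, ψ a) * ψ (-z)) = ∑ ψ : AddChar A ℂ, (∑ a ∈ Y, ψ a) * ψ (-z) from
    sum_congr rfl fun ψ _ => by rw [h ψ], key Y z] at hz
  have hN : (Fintype.card A : ℂ) ≠ 0 := Nat.cast_ne_zero.2 Fintype.card_ne_zero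
  by_cases hX : z ∈ X <;> by_cases hY : z ∈ Y
  · exact iff_of_true hX hY
  · rw [if_pos hX, if_neg hY] at hz; exact absurd hz.symm hN
  · rw [if_neg hX, if_pos hY] at hz; exact absurd hz hN
  · exact iff_of_false hX hY

omit [Fintype A] in
/-- Character sum of the reflected set `κ − X`: `∑_{a ∈ κ−X} ψ a = ψ κ · ∑_{a∈X} ψ(−a)`. [folklore] -/
theorem charsum_image_sub (ψ : AddChar A ℂ) (X : Finset A) (κ : A) :
    ∑ a ∈ X.image (fun b => κ - b), ψ a = ψ κ * ∑ a ∈ X, ψ (-a) := by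
  rw [sum_image fun _ _ _ _ hab => sub_right_injective hab, mul_sum]
  refine sum_congr rfl fun a _ => ?_
  simp only [sub_eq_add_neg, AddChar.map_add_eq_mul]

/-- **Structure theorem, character form.**  `3 ∤ |A|`; `|T₀| = |T₁|`, `|U₀| = |U₁|`; the four unit equations at every
non-trivial character (holes `x₀, x₇, y₀, y₇`).  Then `T₁ = (x₀ − y₀) − T₀` and `U₁ = (x₀ + y₇) − U₀`. [folklore] -/
theorem domino_structure_of_charsums (h3 : ¬ 3 ∣ Fintype.card A) {T₀ T₁ U₀ U₁ : Finset A} {x₀ x₇ y₀ y₇ : A}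
    (hT : T₀.card = T₁.card) (hU : U₀.card = U₁.card)
    (h1 : ∀ ψ : AddChar A ℂ, ψ ≠ 0 →
      ((∑ a ∈ T₀, ψ a) + ∑ a ∈ T₁, ψ a) * (∑ a ∈ U₀, ψ a) + (∑ a ∈ T₀, ψ a) * (∑ a ∈ U₁, ψ a) = -ψ x₀)
    (h2 : ∀ ψ : AddChar A ℂ, ψ ≠ 0 →
      (∑ a ∈ T₁, ψ a) * (∑ a ∈ U₀, ψ a) + ((∑ a ∈ T₀, ψ a) + ∑ a ∈ T₁, ψ a) * (∑ a ∈ U₁, ψ a) = -ψ x₇)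
    (h3' : ∀ ψ : AddChar A ℂ, ψ ≠ 0 →
      ((∑ a ∈ T₀, ψ (-a)) + ∑ a ∈ T₁, ψ (-a)) * (∑ a ∈ U₀, ψ a) + (∑ a ∈ T₁, ψ (-a)) * (∑ a ∈ U₁, ψ a) = -ψ y₀)
    (h4 : ∀ ψ : AddChar A ℂ, ψ ≠ 0 →
      (∑ a ∈ T₀, ψ (-a)) * (∑ a ∈ U₀, ψ a) + ((∑ a ∈ T₀, ψ (-a)) + ∑ a ∈ T₁, ψ (-a)) * (∑ a ∈ U₁, ψ a) = -ψ y₇) :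
    T₁ = T₀.image (fun b => (x₀ - y₀) - b) ∧ U₁ = U₀.image (fun b => (x₀ + y₇) - b) := by
  have main : ∀ ψ : AddChar A ℂ, ψ ≠ 0 →
      (∑ a ∈ T₁, ψ a) = ψ x₀ * ψ (-y₀) * (∑ a ∈ T₀, ψ (-a)) ∧
        (∑ a ∈ U₁, ψ a) = ψ x₀ * ψ y₇ * (∑ a ∈ U₀, ψ (-a)) := by
    intro ψ hψ
    have cj : ∀ X : Finset A, (∑ a ∈ X, ψ (-a)) = (starRingEnd ℂ) (∑ a ∈ X, ψ a) := fun X => (conj_charsum' ψ X).symm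
    have cp : ∀ x : A, ψ (-x) = (starRingEnd ℂ) (ψ x) := fun x => AddChar.map_neg_eq_conj ψ x
    have un : ∀ x : A, ψ x * ψ (-x) = 1 := fun x => by rw [← AddChar.map_add_eq_mul, add_neg_cancel, AddChar.map_zero_eq_one]
    -- conjugate equations
    have g1 := congrArg (starRingEnd ℂ) (h1 ψ hψ)
    have g2 := congrArg (starRingEnd ℂ) (h2 ψ hψ)
    have g3 := congrArg (starRingEnd ℂ) (h3' ψ hψ)
    have g4 := congrArg (starRingEnd ℂ) (h4 ψ hψ)
    simp only [map_add, map_mul, map_neg, ← cj, ← cp] at g1 g2 g3 g4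
    have nn : ∀ X : Finset A, (∑ a ∈ X, ψ (- -a)) = ∑ a ∈ X, ψ a := fun X => by simp only [neg_neg]
    rw [cj, cj] at g3 g4
    simp only [map_sum, ← cp, neg_neg] at g3 g4
    refine reflect_of_unit_eqs (∑ a ∈ T₀, ψ a) (∑ a ∈ T₁, ψ a) (∑ a ∈ T₀, ψ (-a)) (∑ a ∈ T₁, ψ (-a))
      (∑ a ∈ U₀, ψ a) (∑ a ∈ U₁, ψ a) (∑ a ∈ U₀, ψ (-a)) (∑ a ∈ U₁, ψ (-a))
      (ψ x₀) (ψ x₇) (ψ y₀) (ψ y₇) (ψ (-x₀)) (ψ (-x₇)) (ψ (-y₀)) (ψ (-y₇))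
      (cj T₀) (cj T₁) (cj U₀) (cj U₁) (un x₀) (un x₇) (un y₀) (un y₇)
      (h1 ψ hψ) (h2 ψ hψ) (h3' ψ hψ) (h4 ψ hψ) g1 g2 g3 g4
      (charsum_sq_add_mul_add_sq_eq_zero h3 ψ T₀ T₁) (charsum_sq_add_mul_add_sq_eq_zero h3 ψ U₀ U₁)
  constructor
  · refine finset_eq_of_charsum_eq fun ψ => ?_
    rw [charsum_image_sub]
    by_cases hψ : ψ = 0
    · subst hψ
      simp only [AddChar.zero_apply, sum_const, nsmul_eq_mul, mul_one, one_mul]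
      exact_mod_cast hT.symm
    · rw [(main ψ hψ).1, AddChar.map_sub_eq_div, div_eq_mul_inv, ← AddChar.map_neg_eq_inv]
  · refine finset_eq_of_charsum_eq fun ψ => ?_
    rw [charsum_image_sub]
    by_cases hψ : ψ = 0
    · subst hψ
      simp only [AddChar.zero_apply, sum_const, nsmul_eq_mul, mul_one, one_mul]
      exact_mod_cast hU.symm
    · rw [(main ψ hψ).2, AddChar.map_add_eq_mul]

end Fourier

end Summit.MatrixMultiplication.OmegaCensus
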